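/-
Copyright (c) 2026 the pub-hodgecm-mathlib formalisation cell (harness21).  Prover seat hodgecm-mathlib-LH7-p04 (g8; ED. 2 §2 g9), E3 head pen (dealer LH2-plan (g1) 2026-09-02 17:22:05Z; HANDOFF-E3 of
LH3-p04 (g7) §2 «FINAL FILE E3»; CENSUS-E3a v1 748a715383396d15 (L3)).
-/
import Literature.NumberTheory.Rogawski1990.ArchEPAssemblySum               -- ★ E3-SUM (LH3-p04 (g7)): `stableSurjG_of_ballTransfer`; brings ★ E3b, ★ E3-CORE, `orbFamGExt`, `stableSumG`, `bzClassG`, `esymm3`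
import Literature.NumberTheory.Rogawski1990.ArchJumpConstInnerTransport      -- ★ `isIndefiniteAt_of_mem_splitChartPlaces` (a split-chart place is indefinite)
import Literature.NumberTheory.Rogawski1990.ArchJumpBricksOfSides             -- ★ `mem_splitChartPlaces_of_isIndefiniteAt` (the converse at a real frame)
import Literature.NumberTheory.Automorphic.ArchStableClassRegularTorus        -- ★ `im_embedding_diagonal_eq_zero` (a `conj`-fixed diagonal frame is real at every complex place)
import HarnessLib

/-!
# EP assembly, the head: the stable surjection H-S4′ onto the quasi-split atlas `diag(½, 1, −½)` from the ball-by-ball transfers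

Topic `NumberTheory/Rogawski1990`; namespace `Literature.NumberTheory.Rogawski1990`.  THEOREMS ONLY (no definition, no instance, no notation, no named fact, no `sorry`); kernel lane
`--supports stmt-HodgeConjecture-24833`.  Cell `pub/hodgecm-mathlib` (D-0151), crux H413; HCML «GO 500» road N8-INNER ROAD B «EP road» (owner LH2-plan (g1)), brick E3 «EP ASSEMBLY =
H-S4′» — the statement the leaf `F0_P3c_StubN8` v10 consumes (`HS4Rehearsal` ∀-body, `F0/P3c/LH2/LH2-plan/g1/StubN8.paydown.v10rehearsal.LH2plang1.lean` :252–:268, TOKEN FOR TOKEN up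
to the reducible abbreviation `GpInf L H = ↥(arch … 3 H)`).  HONEST LABEL: count-neutral; HC_CM is proved only modulo the 7 printed citations (2 remaining: hLiu418 =
stmt-HodgeConjecture-24832, h413 = stmt-HodgeConjecture-24833) until rung 0 closes; this file pays H-S4′ only MODULO its displayed binders until E3a (L2) discharges `hBall` and (c2)
discharges `hAdd`.

§1 (L3 SKELETON) **`stableSurjG_quasiSplit_of_ballTransfer`** = ★ E3-SUM `stableSurjG_of_ballTransfer` at `β₀ := ![(2:L)⁻¹, 1, -(2:L)⁻¹]`, `D := univ.filter (¬ IsIndefiniteAt (slotSign L α) ·)`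
(= the `α`-DEFINITE places: ★ `isIndefiniteAt_of_mem_splitChartPlaces` ∕ ★ `mem_splitChartPlaces_of_isIndefiniteAt` with `hreal` from the pointwise hermitian guard through ★
`im_embedding_diagonal_eq_zero`), `κ := ∏ _w ∈ D, (3:ℂ)⁻¹`; the guards `hα`, `hherm`, `hanis` of the leaf's sentence in front (the anisotropy guard is carried, not used: the EP road needs
no anisotropy), then the two displayed debts: `hBall` — E3a (L2) `ballTransfer` (∃ radii `ε > 0` with the ball-by-ball transfer for every choice of centres on the compact class image `K` and
smooth factors supported in the `ε`-balls; CENSUS-E3a v1 §3 lists its slices) — and `hAdd` — (c2) additivity of `f ↦ SS_β(f)` over finite sums of test functions on `RegG S` (F0P3b-p01).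
CONCLUSION = H-S4′: `∀ a′ ∈ C_c^∞(U(diag α)_∞), ∃ f ∈ C_c^∞(U(diag β₀)_∞), ∀ S, ∀ c ∈ RegG S, stableSumG (orbFamGExt L β₀ μ f) S c = stableSumG (fun S′ c′ => κ · orbFamGExt L α μ′ a′ S′ c′) S c`.
§2 (to be appended when (L2) lands): the binder-free head `stableSurjG_quasiSplit` with `hEP` (one-place EP generators at the definite places) in front instead of `hBall`.
§2 ED. 2 (LH7-p04 (g9), dealer LH2-plan (g1) 2026-09-02 17:47:44Z (a)): **`stableSurjG_quasiSplit_of_ballTransferFixed`** — the head in its FINAL binder shape `(hα) (hherm) (_hanis)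
(hEP : ∀ w [σ] (νw) [Haar], ∀ l, (∀ i, ‖l i‖ = 1) → EPGeneratorAt L β₀ w νw (esymm3 l))` (discharged by the bare name ★ `epGeneratorAt_esymm3_quasiSplit L`, p852294), followed by ONE
provisional binder `hBT` = the statement of the E3a (L2) glue `ballTransfer_fixed` at the head's data (`hEP → ∀ a′ ∈ C_c^∞, ∃ ε > 0, hBall(a′, ε)` with `D` = the `α`-definite places and
`κ = ∏_{w ∈ D} 3⁻¹`), composed with ★ E3-SUM ED. 2 `stableSurjG_of_ballTransfer_fixed_of_ne_zero` (`hAdd` discharged by ★ (c2), `hβ₀` by ★ `quasiSplitWeights_ne_zero`).  The binder-free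
`stableSurjG_quasiSplit` is §3, appended the day `ballTransfer_fixed` is ★ (its text = §2's with `hBT` deleted and `hBT hEP` replaced by the ★ name).

## References
* [Rogawski1990] J. D. Rogawski, *Automorphic Representations of Unitary Groups in Three Variables*, Ann. of Math. Stud. 123 (1990), §4.1 (4.1.1) p. 39; §14.2 (14.2.1) pp. 232–233.
* [Shelstad1979] D. Shelstad, *Characters and inner forms of a quasi-split group over ℝ*, Compositio Math. 39 (1979), §4 p. 24, Lemma 4.2 p. 23.
* [Bouaziz1994IntegralesOrbitales] A. Bouaziz, *Intégrales orbitales sur les algèbres de Lie réductives*, Invent. Math. 115 (1994), §6.2 p. 591.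
-/

set_option autoImplicit false

noncomputable section

open MeasureTheory NumberField NumberField.InfinitePlace Complex Set Function Metric
open Literature.NumberTheory.Automorphic Literature.NumberTheory.Automorphic.UnitaryGroup Literature.NumberTheory.Automorphic.ArchCartan
open scoped Classical MatrixGroups Matrix ContDiff

namespace Literature.NumberTheory.Rogawski1990

section Head

variable (L : Type) [Field L] [NumberField L] [IsCMField L] (α : Fin 3 → L)
  [MeasurableSpace ↥(arch (↥(maximalRealSubfield L)) L (IsCMField.complexConj L) 3 (Matrix.diagonal α))]
  [BorelSpace ↥(arch (↥(maximalRealSubfield L)) L (IsCMField.complexConj L) 3 (Matrix.diagonal α))]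
  [MeasurableSpace ↥(arch (↥(maximalRealSubfield L)) L (IsCMField.complexConj L) 3 (Matrix.diagonal ![(2 : L)⁻¹, 1, -(2 : L)⁻¹]))]
  [BorelSpace ↥(arch (↥(maximalRealSubfield L)) L (IsCMField.complexConj L) 3 (Matrix.diagonal ![(2 : L)⁻¹, 1, -(2 : L)⁻¹]))]
  (μ' : Measure ↥(arch (↥(maximalRealSubfield L)) L (IsCMField.complexConj L) 3 (Matrix.diagonal α)))
  (μ : Measure ↥(arch (↥(maximalRealSubfield L)) L (IsCMField.complexConj L) 3 (Matrix.diagonal ![(2 : L)⁻¹, 1, -(2 : L)⁻¹])))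
  [μ'.IsHaarMeasure] [μ'.IsMulRightInvariant] [μ.IsHaarMeasure] [μ.IsMulRightInvariant]

omit [MeasurableSpace ↥(arch (↥(maximalRealSubfield L)) L (IsCMField.complexConj L) 3 (Matrix.diagonal α))]
  [BorelSpace ↥(arch (↥(maximalRealSubfield L)) L (IsCMField.complexConj L) 3 (Matrix.diagonal α))]
  [MeasurableSpace ↥(arch (↥(maximalRealSubfield L)) L (IsCMField.complexConj L) 3 (Matrix.diagonal ![(2 : L)⁻¹, 1, -(2 : L)⁻¹]))]
  [BorelSpace ↥(arch (↥(maximalRealSubfield L)) L (IsCMField.complexConj L) 3 (Matrix.diagonal ![(2 : L)⁻¹, 1, -(2 : L)⁻¹]))]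
  [μ'.IsHaarMeasure] [μ'.IsMulRightInvariant] [μ.IsHaarMeasure] [μ.IsMulRightInvariant] in
/-- **The `α`-definite places as a filter of `univ`: `w` is NOT indefinite iff `w` is not a split-chart place** (nondegenerate real diagonal frame). [cite: Rogawski1990, §14.2 p. 232] -/
theorem mem_filter_not_isIndefiniteAt_iff (hα : ∀ i, α i ≠ 0) (hherm : ∀ i, (IsCMField.complexConj L (α i) : L) = α i) (w : {w : InfinitePlace L // IsComplex w}) :
    w ∈ Finset.univ.filter (fun w : {w : InfinitePlace L // IsComplex w} => ¬ IsIndefiniteAt (slotSign L α) w) ↔ w ∉ splitChartPlaces L α := by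
  rw [Finset.mem_filter, and_iff_right (Finset.mem_univ w), not_iff_not]
  exact ⟨mem_splitChartPlaces_of_isIndefiniteAt L α hα (im_embedding_diagonal_eq_zero L 3 α hherm w), isIndefiniteAt_of_mem_splitChartPlaces L α hα⟩

/-- **E3 HEAD, SKELETON (L3): H-S4′ ON THE QUASI-SPLIT ATLAS FROM THE BALL-BY-BALL TRANSFERS.**  At a nondegenerate real (= `conj`-fixed) diagonal frame `α` (anisotropy carried as the leaf's
guard, unused), for free Haar measures `μ′` on `U(diag α)_∞` and `μ` on `U(diag β₀)_∞`: IF (E3a (L2)) for some positive radii `ε` on class space every ball datum `(ctr ∈ K^D, F)` and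
every `a′ ∈ C_c^∞` admit `f ∈ C_c^∞(U(diag β₀)_∞)` with `SS_{β₀}(f) = κ · SS_α((Π_v F v ∘ cl_v) · a′)` on every `RegG S` (`κ = ∏_{w ∈ D} 3⁻¹`, `D` the `α`-definite places), and IF ((c2)) `f ↦ SS_{β₀}(f)`
is additive over finite sums of test functions on `RegG S`, THEN **for every `a′ ∈ C_c^∞(U(diag α)_∞)` there is `f ∈ C_c^∞(U(diag β₀)_∞)` with
`stableSumG (orbFamGExt L β₀ μ f) S c = stableSumG (fun S′ c′ => (∏ _w ∈ univ.filter (¬ IsIndefiniteAt (slotSign L α) ·), 3⁻¹) · orbFamGExt L α μ′ a′ S′ c′) S c` on every `RegG S`** — the leaf's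
`HS4Rehearsal` sentence (★ E3-SUM `stableSurjG_of_ballTransfer` + ★ E3b's class partition inside it). [cite: Rogawski1990, §14.2 (14.2.1) p. 232; §4.1 (4.1.1) p. 39]
[cite: Shelstad1979, §4 p. 24, Lemma 4.2 p. 23] [cite: Bouaziz1994IntegralesOrbitales, §6.2 p. 591] -/
theorem stableSurjG_quasiSplit_of_ballTransfer (hα : ∀ i, α i ≠ 0) (hherm : ∀ i, (IsCMField.complexConj L (α i) : L) = α i)
    (_hanis : ∀ x : Fin 3 → L, hermForm (cmConjRingHom L) (Matrix.diagonal α) x x = 0 → x = 0)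
    (hBall : ∃ ε : {w : InfinitePlace L // IsComplex w} → ℂ × ℂ × ℂ → ℝ, (∀ w b, 0 < ε w b) ∧
      ∀ (ctr : ↥(Finset.univ.filter (fun w : {w : InfinitePlace L // IsComplex w} => ¬ IsIndefiniteAt (slotSign L α) w)) → ℂ × ℂ × ℂ)
        (F : ↥(Finset.univ.filter (fun w : {w : InfinitePlace L // IsComplex w} => ¬ IsIndefiniteAt (slotSign L α) w)) → ℂ × ℂ × ℂ → ℝ),
        (∀ v, ctr v ∈ Set.range fun t : Fin 3 → ℝ => esymm3 fun i => Complex.exp ((t i : ℂ) * I)) → (∀ v, ContDiff ℝ ∞ (F v)) →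
        (∀ v, tsupport (F v) ⊆ ball (ctr v) (ε v (ctr v))) →
        ∀ a' : ↥(arch (↥(maximalRealSubfield L)) L (IsCMField.complexConj L) 3 (Matrix.diagonal α)) → ℂ, ArchSmooth L 3 (Matrix.diagonal α) a' →
          ∃ f : ↥(arch (↥(maximalRealSubfield L)) L (IsCMField.complexConj L) 3 (Matrix.diagonal ![(2 : L)⁻¹, 1, -(2 : L)⁻¹])) → ℂ,
            ArchSmooth L 3 (Matrix.diagonal ![(2 : L)⁻¹, 1, -(2 : L)⁻¹]) f ∧
            ∀ (S : Finset {w : InfinitePlace L // IsComplex w}) (c : {w : InfinitePlace L // IsComplex w} → Fin 3 → ℝ), c ∈ RegG S →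
              stableSumG (orbFamGExt L ![(2 : L)⁻¹, 1, -(2 : L)⁻¹] μ f) S c =
                (∏ _w ∈ Finset.univ.filter (fun w : {w : InfinitePlace L // IsComplex w} => ¬ IsIndefiniteAt (slotSign L α) w), (3 : ℂ)⁻¹) *
                  stableSumG (orbFamGExt L α μ' (fun k => ((∏ v, F v (bzClassG L α k v) : ℝ) : ℂ) * a' k)) S c)
    (hAdd : ∀ {ι : Type} (s : Finset ι) (f : ι → ↥(arch (↥(maximalRealSubfield L)) L (IsCMField.complexConj L) 3 (Matrix.diagonal ![(2 : L)⁻¹, 1, -(2 : L)⁻¹])) → ℂ),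
      (∀ i ∈ s, ArchSmooth L 3 (Matrix.diagonal ![(2 : L)⁻¹, 1, -(2 : L)⁻¹]) (f i)) →
      ∀ (S : Finset {w : InfinitePlace L // IsComplex w}) (c : {w : InfinitePlace L // IsComplex w} → Fin 3 → ℝ), c ∈ RegG S →
        stableSumG (orbFamGExt L ![(2 : L)⁻¹, 1, -(2 : L)⁻¹] μ (∑ i ∈ s, f i)) S c = ∑ i ∈ s, stableSumG (orbFamGExt L ![(2 : L)⁻¹, 1, -(2 : L)⁻¹] μ (f i)) S c) :
    ∀ a' : ↥(arch (↥(maximalRealSubfield L)) L (IsCMField.complexConj L) 3 (Matrix.diagonal α)) → ℂ, ArchSmooth L 3 (Matrix.diagonal α) a' →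
      ∃ f : ↥(arch (↥(maximalRealSubfield L)) L (IsCMField.complexConj L) 3 (Matrix.diagonal ![(2 : L)⁻¹, 1, -(2 : L)⁻¹])) → ℂ,
        ArchSmooth L 3 (Matrix.diagonal ![(2 : L)⁻¹, 1, -(2 : L)⁻¹]) f ∧
          ∀ (S : Finset {w : InfinitePlace L // IsComplex w}) (c : {w : InfinitePlace L // IsComplex w} → Fin 3 → ℝ), c ∈ RegG S →
            stableSumG (orbFamGExt L ![(2 : L)⁻¹, 1, -(2 : L)⁻¹] μ f) S c =
              stableSumG (fun S' c' => (∏ _w ∈ Finset.univ.filter (fun w : {w : InfinitePlace L // IsComplex w} => ¬ IsIndefiniteAt (slotSign L α) w), (3 : ℂ)⁻¹) *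
                orbFamGExt L α μ' a' S' c') S c := by
  intro a' ha'
  obtain ⟨ε, hε, hB⟩ := hBall
  exact stableSurjG_of_ballTransfer L α ![(2 : L)⁻¹, 1, -(2 : L)⁻¹] μ' μ
    (Finset.univ.filter (fun w : {w : InfinitePlace L // IsComplex w} => ¬ IsIndefiniteAt (slotSign L α) w)) (mem_filter_not_isIndefiniteAt_iff L α hα hherm) ε hε _ hB hAdd a' ha'

end Head

/-! ## §2 (ED. 2) — the head in its final binder shape, the (L2) glue carried as ONE provisional binder -/

section HeadOfBallTransferFixed

variable (L : Type) [Field L] [NumberField L] [IsCMField L] (α : Fin 3 → L)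
  [MeasurableSpace ↥(arch (↥(maximalRealSubfield L)) L (IsCMField.complexConj L) 3 (Matrix.diagonal α))]
  [BorelSpace ↥(arch (↥(maximalRealSubfield L)) L (IsCMField.complexConj L) 3 (Matrix.diagonal α))]
  [MeasurableSpace ↥(arch (↥(maximalRealSubfield L)) L (IsCMField.complexConj L) 3 (Matrix.diagonal ![(2 : L)⁻¹, 1, -(2 : L)⁻¹]))]
  [BorelSpace ↥(arch (↥(maximalRealSubfield L)) L (IsCMField.complexConj L) 3 (Matrix.diagonal ![(2 : L)⁻¹, 1, -(2 : L)⁻¹]))]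
  (μ' : Measure ↥(arch (↥(maximalRealSubfield L)) L (IsCMField.complexConj L) 3 (Matrix.diagonal α)))
  (μ : Measure ↥(arch (↥(maximalRealSubfield L)) L (IsCMField.complexConj L) 3 (Matrix.diagonal ![(2 : L)⁻¹, 1, -(2 : L)⁻¹])))
  [μ'.IsHaarMeasure] [μ'.IsMulRightInvariant] [μ.IsHaarMeasure] [μ.IsMulRightInvariant]

/-- **E3 HEAD IN ITS FINAL BINDER SHAPE, MODULO THE (L2) GLUE (ED. 2).**  At a nondegenerate real diagonal frame `α` (anisotropy carried as the leaf's guard, unused), for free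
right-invariant Haar measures `μ′` on `U(diag α)_∞` and `μ` on `U(diag β₀)_∞`, `β₀ = (½, 1, −½)`: GIVEN the one-place Euler–Poincaré generators `hEP` at every elliptic class
`esymm3 l` (`|l_i| = 1`) of `U(β₀)_w` for every complex place `w`, every Borel structure and every right-invariant Haar measure `ν_w` there (E1's head `EPGeneratorAt`; discharged by
★ EP-ALL `epGeneratorAt_esymm3_quasiSplit L`), and GIVEN (`hBT`, the ONE provisional binder = the E3a (L2) glue `ballTransfer_fixed` at this data) that these generators yield, for
every `a′ ∈ C_c^∞(U(diag α)_∞)`, positive radii `ε` on class space and the ball-by-ball transfer `SS_{β₀}(f) = (∏_{w ∈ D} 3⁻¹) · SS_α((Π_v F v ∘ cl_v) · a′)` on every `RegG S` for every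
ball datum `(ctr ∈ K^D, F)` supported in the `ε`-balls (`D` = the `α`-definite places), THEN H-S4′: **for every `a′ ∈ C_c^∞(U(diag α)_∞)` there is `f ∈ C_c^∞(U(diag β₀)_∞)` with
`stableSumG (orbFamGExt L β₀ μ f) S c = stableSumG (fun S′ c′ => (∏_{w ∈ D} 3⁻¹) · orbFamGExt L α μ′ a′ S′ c′) S c` on every `RegG S`** — ★ E3-SUM ED. 2
`stableSurjG_of_ballTransfer_fixed_of_ne_zero` (additivity `hAdd` discharged by ★ (c2); `β₀` has non-zero entries ★ `quasiSplitWeights_ne_zero`).  The binder-free head is §3.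
[cite: Rogawski1990, §14.2 (14.2.1) p. 232; §4.1 (4.1.1) p. 39] [cite: Shelstad1979, §4 p. 24, Lemma 4.2 p. 23] [cite: Bouaziz1994IntegralesOrbitales, §6.2 p. 591] -/
theorem stableSurjG_quasiSplit_of_ballTransferFixed (hα : ∀ i, α i ≠ 0) (hherm : ∀ i, (IsCMField.complexConj L (α i) : L) = α i)
    (_hanis : ∀ x : Fin 3 → L, hermForm (cmConjRingHom L) (Matrix.diagonal α) x x = 0 → x = 0)
    (hEP : ∀ (w : {w : InfinitePlace L // IsComplex w})
      [MeasurableSpace ↥(archLocal L 3 (Matrix.diagonal ![(2 : L)⁻¹, 1, -(2 : L)⁻¹]) w)] [BorelSpace ↥(archLocal L 3 (Matrix.diagonal ![(2 : L)⁻¹, 1, -(2 : L)⁻¹]) w)]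
      (νw : Measure ↥(archLocal L 3 (Matrix.diagonal ![(2 : L)⁻¹, 1, -(2 : L)⁻¹]) w)) [νw.IsHaarMeasure] [νw.IsMulRightInvariant]
      (l : Fin 3 → ℂ), (∀ i, ‖l i‖ = 1) → EPGeneratorAt L ![(2 : L)⁻¹, 1, -(2 : L)⁻¹] w νw (esymm3 l))
    (hBT : (∀ (w : {w : InfinitePlace L // IsComplex w})
        [MeasurableSpace ↥(archLocal L 3 (Matrix.diagonal ![(2 : L)⁻¹, 1, -(2 : L)⁻¹]) w)] [BorelSpace ↥(archLocal L 3 (Matrix.diagonal ![(2 : L)⁻¹, 1, -(2 : L)⁻¹]) w)]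
        (νw : Measure ↥(archLocal L 3 (Matrix.diagonal ![(2 : L)⁻¹, 1, -(2 : L)⁻¹]) w)) [νw.IsHaarMeasure] [νw.IsMulRightInvariant]
        (l : Fin 3 → ℂ), (∀ i, ‖l i‖ = 1) → EPGeneratorAt L ![(2 : L)⁻¹, 1, -(2 : L)⁻¹] w νw (esymm3 l)) →
      ∀ a' : ↥(arch (↥(maximalRealSubfield L)) L (IsCMField.complexConj L) 3 (Matrix.diagonal α)) → ℂ, ArchSmooth L 3 (Matrix.diagonal α) a' →
        ∃ ε : {w : InfinitePlace L // IsComplex w} → ℂ × ℂ × ℂ → ℝ, (∀ w b, 0 < ε w b) ∧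
          ∀ (ctr : ↥(Finset.univ.filter (fun w : {w : InfinitePlace L // IsComplex w} => ¬ IsIndefiniteAt (slotSign L α) w)) → ℂ × ℂ × ℂ)
            (F : ↥(Finset.univ.filter (fun w : {w : InfinitePlace L // IsComplex w} => ¬ IsIndefiniteAt (slotSign L α) w)) → ℂ × ℂ × ℂ → ℝ),
            (∀ v, ctr v ∈ Set.range fun t : Fin 3 → ℝ => esymm3 fun i => Complex.exp ((t i : ℂ) * I)) → (∀ v, ContDiff ℝ ∞ (F v)) →
            (∀ v, tsupport (F v) ⊆ ball (ctr v) (ε v (ctr v))) →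
              ∃ f : ↥(arch (↥(maximalRealSubfield L)) L (IsCMField.complexConj L) 3 (Matrix.diagonal ![(2 : L)⁻¹, 1, -(2 : L)⁻¹])) → ℂ,
                ArchSmooth L 3 (Matrix.diagonal ![(2 : L)⁻¹, 1, -(2 : L)⁻¹]) f ∧
                ∀ (S : Finset {w : InfinitePlace L // IsComplex w}) (c : {w : InfinitePlace L // IsComplex w} → Fin 3 → ℝ), c ∈ RegG S →
                  stableSumG (orbFamGExt L ![(2 : L)⁻¹, 1, -(2 : L)⁻¹] μ f) S c =
                    (∏ _w ∈ Finset.univ.filter (fun w : {w : InfinitePlace L // IsComplex w} => ¬ IsIndefiniteAt (slotSign L α) w), (3 : ℂ)⁻¹) *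
                      stableSumG (orbFamGExt L α μ' (fun k => ((∏ v, F v (bzClassG L α k v) : ℝ) : ℂ) * a' k)) S c) :
    ∀ a' : ↥(arch (↥(maximalRealSubfield L)) L (IsCMField.complexConj L) 3 (Matrix.diagonal α)) → ℂ, ArchSmooth L 3 (Matrix.diagonal α) a' →
      ∃ f : ↥(arch (↥(maximalRealSubfield L)) L (IsCMField.complexConj L) 3 (Matrix.diagonal ![(2 : L)⁻¹, 1, -(2 : L)⁻¹])) → ℂ,
        ArchSmooth L 3 (Matrix.diagonal ![(2 : L)⁻¹, 1, -(2 : L)⁻¹]) f ∧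
          ∀ (S : Finset {w : InfinitePlace L // IsComplex w}) (c : {w : InfinitePlace L // IsComplex w} → Fin 3 → ℝ), c ∈ RegG S →
            stableSumG (orbFamGExt L ![(2 : L)⁻¹, 1, -(2 : L)⁻¹] μ f) S c =
              stableSumG (fun S' c' => (∏ _w ∈ Finset.univ.filter (fun w : {w : InfinitePlace L // IsComplex w} => ¬ IsIndefiniteAt (slotSign L α) w), (3 : ℂ)⁻¹) *
                orbFamGExt L α μ' a' S' c') S c := by
  intro a' ha'
  obtain ⟨ε, hε, hB⟩ := hBT hEP a' ha'
  exact stableSurjG_of_ballTransfer_fixed_of_ne_zero L α ![(2 : L)⁻¹, 1, -(2 : L)⁻¹] μ' μ (quasiSplitWeights_ne_zero L)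
    (Finset.univ.filter (fun w : {w : InfinitePlace L // IsComplex w} => ¬ IsIndefiniteAt (slotSign L α) w)) (mem_filter_not_isIndefiniteAt_iff L α hα hherm) a' ε hε _ hB

end HeadOfBallTransferFixed

end Literature.NumberTheory.Rogawski1990
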